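/-
Copyright (c) 2026 the pub-hodgecm-mathlib formalisation cell (harness21).  Prover seat hodgecm-mathlib-LH4-p11 (g5), req620 Track A «(D-RAM) FOUR-FRAME» squad
(unit U2H_HSide, the (ρ2b′-X) road :418; bottom socket (A), recipe item 12 «the V-choice»).
-/
import Literature.NumberTheory.Rogawski1990.FinExplicitTransferFactorLeviStratumGerm   -- ★ `exists_nhds_one_congrOne_endoEmbLocal`
import Literature.NumberTheory.Rogawski1990.FinExplicitTransferFactor                  -- ★ `finGammaTwo`
import HarnessLib

/-!
# Crux `H413`, line LH4 «(D-RAM) FOUR-FRAME» — the (ρ2b′-X) road, bottom sockets: THE BLOCKS OF `γ_H` ARE CONGRUENT TO `1` NEAR `1 ∈ H_v`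

Cell `hodgecm-mathlib` (D-0151), FLOOR 0, crux item H413 = `stmt-HodgeConjecture-24833`; squad F0∕P3c∕LH4; bottom sockets (A)∕(B)∕(C) (dealer MAP v3, LH4-p14 (g4)):
the bottom prover CHOOSES `V ∈ 𝓝 1`.  ★ `exists_nhds_one_congrOne_endoEmbLocal` gives `ι_v(γ_H)_w ≡ 1 (mod c)` entrywise on `V`; read through the printed picture ★
`coe_endoGL_eq` (`ι(g, u) = (a 0 b; 0 u 0; c 0 d)`) this is: THE `U(Φ₂)`-BLOCK `g_w := g.map eval_w` IS `≡ 1 (mod c)` ENTRYWISE AND `γ₂,w := finGammaTwo_w ≡ 1 (mod c)` — exactly the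
hypotheses `hg`, `hu` of ★ `F0P3cDyRamTypeTwoTubeLetters` (`|tr g_w − 2| ≤ |c|`, `|det g_w − 1| ≤ |c|`, the (C2) tube, the depth bound).
THEOREMS ONLY (no `def`, no instance, no notation, no `sorry`); lane `--supports stmt-HodgeConjecture-24833 --as helper` (count-neutral).
HONEST LABEL.  Count-neutral; nothing printed is asserted; (ρ2b′-X) stays OPEN; `HC_CM` is proved only modulo the 7 printed citations (2 remaining named inputs: hLiu418 =
`stmt-HodgeConjecture-24832`, h413 = `stmt-HodgeConjecture-24833`) until rung 0 closes.

## References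
* [Rogawski1990] J. D. Rogawski, *Automorphic Representations of Unitary Groups in Three Variables*, Ann. of Math. Stud. 123 (1990), §4.8 Case (a) p. 53 (the embedding
  `ι`), §4.9 p. 54 (elements near `1`), p. 55 (`γ₂`).
* [BernsteinZelevinsky1976] I. N. Bernstein, A. V. Zelevinsky, *Representations of GL(n, F)*, Russian Math. Surveys 31 (1976), §1.1 (congruence neighbourhoods).
-/

set_option autoImplicit false

noncomputable section

open NumberField IsDedekindDomain Matrix Topology Filter
open scoped Valued Matrix MatrixGroups

namespace Summit.HodgeConjecture.HodgeConjecture.Cruxes.H413.F0P3cDyRamTypeTwoBlockCongruenceNhds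

open Literature.NumberTheory.Automorphic Literature.NumberTheory.Automorphic.UnitaryGroup
open Literature.NumberTheory.Rogawski1990

variable (L : Type) [Field L] [NumberField L] [IsCMField L] (v : HeightOneSpectrum (𝓞 ↥(maximalRealSubfield L))) (w : PlacesOver L v)

set_option maxHeartbeats 1600000 in
set_option synthInstance.maxHeartbeats 400000 in
-- cold instance-term unification on the CM local carriers (VERBATIM budget of ★ `exists_nhds_one_congrOne_endoEmbLocal`, whose statement this re-reads)
/-- **NEAR `1 ∈ H_v` BOTH BLOCKS OF `γ_H` ARE `≡ 1 (mod c)` AT `w`** (`c ≠ 0` in `L_w`): there is `V ∈ 𝓝 1` such that for every `γ_H = (g, γ₂) ∈ V` the block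
`g_w = g.map eval_w` satisfies `|(g_w − 1)_{ij}|_w ≤ |c|_w` for all `i, j`, and `|γ₂,w − 1|_w ≤ |c|_w` (★ `exists_nhds_one_congrOne_endoEmbLocal` read through ★ `coe_endoGL_eq`).
[cite: Rogawski1990, §4.8 Case (a) p. 53; §4.9 p. 54] [cite: BernsteinZelevinsky1976, §1.1] -/
theorem exists_nhds_one_block_congr {c : w.1.adicCompletion L} (hc : c ≠ 0) :
    ∃ V ∈ 𝓝 (1 : (cmDatum L 2 (Matrix.of fun i j : Fin 2 => if i.val + j.val + 1 = 2 then (1 : L) else 0)).Local v ×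
        (cmDatum L 1 (Matrix.of fun i j : Fin 1 => if i.val + j.val + 1 = 1 then (1 : L) else 0)).Local v),
      ∀ γH ∈ V,
        (∀ i j : Fin 2, Valued.v ((((γH.1.val : GL (Fin 2) (UnitaryGroup.LocalRing L v)).val.map
            (Pi.evalRingHom (fun w' : UnitaryGroup.PlacesOver L v => w'.1.adicCompletion L) w)) i j -
              (1 : Matrix (Fin 2) (Fin 2) (w.1.adicCompletion L)) i j)) ≤ Valued.v c) ∧
        Valued.v (finGammaTwo L v γH w - 1) ≤ Valued.v c := by
  obtain ⟨V, hV, hVd⟩ := exists_nhds_one_congrOne_endoEmbLocal L v w hc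
  refine ⟨V, hV, fun γH hγ => ?_⟩
  have h := hVd γH hγ
  simp only [coe_endoEmbLocal, coe_endoGL_eq, Matrix.map_apply] at h
  refine ⟨fun i j => ?_, ?_⟩
  · fin_cases i <;> fin_cases j
    · simpa [Matrix.one_apply] using h 0 0
    · simpa [Matrix.one_apply] using h 0 2
    · simpa [Matrix.one_apply] using h 2 0
    · simpa [Matrix.one_apply] using h 2 2
  · simpa [Matrix.one_apply, finGammaTwo] using h 1 1

end Summit.HodgeConjecture.HodgeConjecture.Cruxes.H413.F0P3cDyRamTypeTwoBlockCongruenceNhds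

end
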